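import Literature.Computability.Complexity.FoldBricks
import Literature.Computability.Complexity.KannanLanguage
import HarnessLib

/-!
# Refuters for `⊕P`: the binary search of a run and its local certificates

Topic `Literature/Computability/MetaComplexity`; first support file of the proof of
`constructiveSeparation_of_not_subset_BPP_ParityP` (`ConstructiveSeparations.lean`: Chen–Jin–
Santhanam–Williams, *Constructive separations and their consequences*, FOCS 2021 / TheoretiCS 2024
= arXiv:2203.14379v5, Thm. 1.2, second sentence, with `𝒞 = BPP`: "`⊕P ⊄ 𝒞` implies that for every
paddable `⊕P`-complete language `L`, there is a `BPP`-constructive separation of `L ∉ 𝒞`").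

The printed proof (§5.3, "Theorem 7", a *proof sketch*) finds, with the refuted algorithm `A` as an
oracle, a locally inconsistent triple `A(R φ) ≠ A(R φ₀) ⊕ A(R φ₁)` by a search-to-decision
reduction through Valiant–Vazirani, and ends with "three strings which contain a counterexample".
This file isolates the purely combinatorial heart of ONE RUN of such a search in the form used by
the tree's proof (`ConstructiveSeparationsProofs.lean`, whose module docstring has the complete
architecture): a **numeric binary search for the least locally-inconsistent instance**, driven by
an arbitrary (adversarial) answer function `ans` on `S`-bit little-endian words (`bitsToNat`), and
the LOCAL CERTIFICATES it leaves behind whatever `ans` does: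

* `predLE` — predecessor of a little-endian word (`bitsToNat_predLE`); `zeros` (injectivity of
  `bitsToNat` on words of one length is the tree's `Kannan.eq_of_bitsToNat_eq`);
* `bquery`/`bstep`/`bsearch` — the search from the top bit: with determined high part `y`, query
  `1^{S-|y|-1} 0 y` and prepend `0` on a YES, `1` on a NO; **invariants for every oracle with
  `ans 1^S = true`**: `ans (bsearch ans S) = true` (`ans_bsearch`) and
  `bsearch ans S = 0^S ∨ ans (predLE (bsearch ans S)) = false` (`bsearch_zeros_or`) — the two
  answers a binary search ends on are literally observed;
* `QLe S Φ t` ("some `Φ`-word has value `≤ ⟦t⟧`"), `Below S Φ t` ("… `< ⟦t⟧`") for a predicate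
  `Φ` (in the application: local inconsistency of `A` at the instance coded by `t`), their
  monotonicity, and the **trichotomy** `trichotomy`: every `S`-bit `t` is the minimum of `Φ`
  (`Φ t ∧ ¬ Below t`), or has a `Φ`-word below it, or has none at or below it;
* **guilt lemmas** (`Guilty ans tv t : tv t ≠ ans t`, "`A` errs on the proxy of `t`", where the
  true value `tv` of the proxies is `QLe` — the event that the randomized `⊕P`-proxies are all
  correct): a NO at the top while `Φ ≠ ∅` convicts the top proxy (`guilty_ones`); a `Φ`-word
  strictly below the search result `t̂` convicts the proxy of `predLE t̂` (`guilty_predLE_bsearch`);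
  no `Φ`-word at or below `t̂` convicts the proxy of `t̂` (`guilty_bsearch`). Together with the
  trichotomy (the remaining case `t̂ = min Φ` is the canonical one, `eq_of_isMin`) this is the
  case analysis behind the four output slots of the refuter.

Everything here is elementary and fully proved; no complexity theory is imported beyond the
tree's binary numerals `bitsToNat`/`ones`.

## References

* L. Chen, C. Jin, R. Santhanam, R. Williams, *Constructive separations and their consequences*,
  arXiv:2203.14379v5, Thm. 1.2 and §5 (Lemma "list-refuters", Thm. "Refuters for PSPACE, EXP, NEXP"
  — the prefix search with local consistency checks — and §5.3) [ChenEtAl2022].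
* S. Arora, B. Barak, *Computational Complexity: A Modern Approach*, CUP 2009, §2.5 (search to
  decision by binary search) [AroraBarak2009].
-/

namespace Literature.Computability.MetaComplexity

open _root_.Computability Complexity Brick

namespace ParityRefuter

/-! ### Little-endian words -/

/-- `zeros k = 0ᵏ`. [folklore] -/
def zeros (k : ℕ) : List Bool := List.replicate k false

/-- `|0ᵏ| = k`. [folklore] -/
@[simp] theorem length_zeros (k : ℕ) : (zeros k).length = k := by simp [zeros]

/-- `0⁰ = ε`. [folklore] -/
@[simp] theorem zeros_zero : zeros 0 = [] := rfl

/-- `⟦0ᵏ⟧ = 0`. [folklore] -/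
@[simp] theorem bitsToNat_zeros (k : ℕ) : bitsToNat (zeros k) = 0 := by simp [zeros]

/-- `0 :: 0ᵏ = 0ᵏ⁺¹`. [folklore] -/
theorem false_cons_zeros (k : ℕ) : false :: zeros k = zeros (k + 1) := by
  simp [zeros, List.replicate_succ]

/-- `0ᵃ ++ 0ᵇ = 0ᵃ⁺ᵇ`. [folklore] -/
theorem zeros_append_zeros (a b : ℕ) : zeros a ++ zeros b = zeros (a + b) := by
  simp [zeros]

/-- `|1ᵏ| = k`. [folklore] -/
@[simp] theorem length_ones' (k : ℕ) : (ones k).length = k := by simp [ones]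

/-- `1ᵃ ++ 1 :: y = 1ᵃ⁺¹ ++ y`. [folklore] -/
theorem ones_append_true_cons (a : ℕ) (y : List Bool) : ones a ++ true :: y = ones (a + 1) ++ y := by
  change List.replicate a true ++ true :: y = List.replicate (a + 1) true ++ y
  rw [List.replicate_succ', List.append_assoc]
  rfl

/-- `0ᵃ ++ 0 :: y = 0ᵃ⁺¹ ++ y`. [folklore] -/
theorem zeros_append_false_cons (a : ℕ) (y : List Bool) : zeros a ++ false :: y = zeros (a + 1) ++ y := by
  change List.replicate a false ++ false :: y = List.replicate (a + 1) false ++ y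
  rw [List.replicate_succ', List.append_assoc]
  rfl

/-- A word of value `0` is `0…0`. [folklore] -/
theorem eq_zeros_of_bitsToNat_eq_zero : ∀ {t : List Bool}, bitsToNat t = 0 → t = zeros t.length
  | [], _ => rfl
  | b :: l, h => by
    rw [bitsToNat_cons] at h
    cases b
    · have hl : bitsToNat l = 0 := by simp at h; omega
      rw [List.length_cons, ← false_cons_zeros, ← eq_zeros_of_bitsToNat_eq_zero hl]
    · simp at h

/-- Every `S`-bit word has value at most `⟦1^S⟧ = 2^S - 1`. [folklore] -/
theorem bitsToNat_le_bitsToNat_ones {t : List Bool} {S : ℕ} (h : t.length = S) :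
    bitsToNat t ≤ bitsToNat (ones S) := by
  rw [bitsToNat_ones]
  have := bitsToNat_lt t
  rw [h] at this
  omega

/-- **Predecessor of a little-endian word** (length-preserving; `0…0 ↦ 1…1` is junk, excluded by
`bitsToNat t ≠ 0` where it matters). [folklore] -/
def predLE : List Bool → List Bool
  | [] => []
  | true :: l => false :: l
  | false :: l => true :: predLE l

/-- `predLE` preserves length. [folklore] -/
@[simp] theorem length_predLE : ∀ t : List Bool, (predLE t).length = t.length
  | [] => rfl
  | true :: l => rfl
  | false :: l => by simp [predLE, length_predLE l]

/-- `predLE (0ᵏ ++ 1 :: y) = 1ᵏ ++ 0 :: y` (borrow through the low zeros). [folklore] -/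
theorem predLE_zeros_append_true_cons (k : ℕ) (y : List Bool) :
    predLE (zeros k ++ true :: y) = ones k ++ false :: y := by
  induction k with
  | zero => rfl
  | succ k ih =>
    rw [← false_cons_zeros, List.cons_append, predLE, ih]
    rfl

/-- **`⟦predLE t⟧ = ⟦t⟧ - 1`** for `⟦t⟧ ≠ 0`. [folklore] -/
theorem bitsToNat_predLE : ∀ {t : List Bool}, bitsToNat t ≠ 0 → bitsToNat (predLE t) = bitsToNat t - 1
  | [], h => by simp at h
  | true :: l, _ => by simp [predLE]
  | false :: l, h => by
    have hl : bitsToNat l ≠ 0 := by simpa using h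
    rw [predLE, bitsToNat_cons, bitsToNat_cons, bitsToNat_predLE hl]
    simp
    omega

/-! ### Binary search from the top bit -/

/-- The query with determined high part `y`: `1^{S-|y|-1} 0 y`, of value
`⟦y⟧·2^{S-|y|} + 2^{S-|y|-1} - 1` — the largest word whose next bit is `0`. [cite: AroraBarak2009, §2.5] -/
def bquery (S : ℕ) (y : List Bool) : List Bool := ones (S - y.length - 1) ++ false :: y

/-- One round: query, and prepend `0` on a YES (`ans = true`: "some `Φ`-word is `≤` the query"),
`1` on a NO. [cite: AroraBarak2009, §2.5] -/
def bstep (ans : List Bool → Bool) (S : ℕ) (y : List Bool) : List Bool := (!ans (bquery S y)) :: y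

/-- **The binary search**: `S` rounds of `bstep` from the empty high part. [cite: AroraBarak2009, §2.5] -/
def bsearch (ans : List Bool → Bool) (S : ℕ) : List Bool := (bstep ans S)^[S] []

/-- The current upper end `1^{S-|y|} y` of the search interval. [folklore] -/
def hiOf (S : ℕ) (y : List Bool) : List Bool := ones (S - y.length) ++ y

/-- The current lower end `0^{S-|y|} y` of the search interval. [folklore] -/
def loOf (S : ℕ) (y : List Bool) : List Bool := zeros (S - y.length) ++ y

/-- After `j` rounds the high part has `j` bits. [folklore] -/
@[simp] theorem length_iterate_bstep (ans : List Bool → Bool) (S : ℕ) : ∀ j : ℕ,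
    ((bstep ans S)^[j] []).length = j
  | 0 => rfl
  | j + 1 => by rw [Function.iterate_succ_apply', bstep, List.length_cons, length_iterate_bstep ans S j]

/-- The result has `S` bits. [folklore] -/
@[simp] theorem length_bsearch (ans : List Bool → Bool) (S : ℕ) : (bsearch ans S).length = S :=
  length_iterate_bstep ans S S

/-- **Upper invariant**: if the top query `1^S` is answered YES, the upper end of the interval is
always an observed YES. [cite: AroraBarak2009, §2.5] -/
theorem ans_hiOf_iterate {ans : List Bool → Bool} {S : ℕ} (h : ans (ones S) = true) :
    ∀ j : ℕ, j ≤ S → ans (hiOf S ((bstep ans S)^[j] [])) = true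
  | 0, _ => by simpa [hiOf] using h
  | j + 1, hj => by
    have ih := ans_hiOf_iterate h j (Nat.le_of_succ_le hj)
    rw [Function.iterate_succ_apply']
    set y := (bstep ans S)^[j] [] with hy
    have hlen : y.length = j := length_iterate_bstep ans S j
    simp only [hiOf, bstep, List.length_cons, hlen] at ih ⊢
    cases hq : ans (bquery S y)
    · -- NO: new bit `1`, upper end unchanged
      simp only [Bool.not_false]
      rw [ones_append_true_cons, show S - (j + 1) + 1 = S - j by omega]
      exact ih
    · -- YES: new bit `0`, upper end is the query
      simp only [Bool.not_true]
      have : ones (S - (j + 1)) ++ false :: y = bquery S y := by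
        rw [bquery, hlen, Nat.sub_sub]
      rw [this, hq]

/-- **Lower invariant**: the lower end of the interval is `0^S`, or its predecessor is an observed
NO. [cite: AroraBarak2009, §2.5] -/
theorem iterate_bstep_zeros_or (ans : List Bool → Bool) (S : ℕ) :
    ∀ j : ℕ, j ≤ S → (bstep ans S)^[j] [] = zeros j ∨ ans (predLE (loOf S ((bstep ans S)^[j] []))) = false
  | 0, _ => Or.inl rfl
  | j + 1, hj => by
    have ih := iterate_bstep_zeros_or ans S j (Nat.le_of_succ_le hj)
    rw [Function.iterate_succ_apply']
    set y := (bstep ans S)^[j] [] with hy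
    have hlen : y.length = j := length_iterate_bstep ans S j
    simp only [loOf, bstep, List.length_cons, hlen] at ih ⊢
    cases hq : ans (bquery S y)
    · -- NO: new bit `1`; the predecessor of the lower end is the query
      refine Or.inr ?_
      simp only [Bool.not_false]
      rw [predLE_zeros_append_true_cons]
      have : ones (S - (j + 1)) ++ false :: y = bquery S y := by rw [bquery, hlen, Nat.sub_sub]
      rw [this, hq]
    · -- YES: new bit `0`; lower end unchanged
      simp only [Bool.not_true]
      rcases ih with h0 | h1
      · left
        rw [h0, false_cons_zeros]
      · right
        rw [zeros_append_false_cons, show S - (j + 1) + 1 = S - j by omega]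
        exact h1

/-- **The result is an observed YES** (for an oracle answering YES at the top). [cite: AroraBarak2009, §2.5] -/
theorem ans_bsearch {ans : List Bool → Bool} {S : ℕ} (h : ans (ones S) = true) : ans (bsearch ans S) = true := by
  have := ans_hiOf_iterate h S le_rfl
  simpa [hiOf, bsearch] using this

/-- **The predecessor of the result is an observed NO**, unless the result is `0^S`. [cite: AroraBarak2009, §2.5] -/
theorem bsearch_zeros_or (ans : List Bool → Bool) (S : ℕ) :
    bsearch ans S = zeros S ∨ ans (predLE (bsearch ans S)) = false := by
  have := iterate_bstep_zeros_or ans S S le_rfl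
  simpa [loOf, bsearch] using this

/-! ### Words with a `Φ`-word at or below, strictly below -/

section Order

variable (S : ℕ) (Φ : List Bool → Prop)

/-- `QLe S Φ t`: some `S`-bit word satisfying `Φ` has value `≤ ⟦t⟧` — the statement the proxy of
`t` encodes ("is the least inconsistent instance `≤ t`?"). [cite: ChenEtAl2022, §5.3] -/
def QLe (t : List Bool) : Prop := ∃ t' : List Bool, t'.length = S ∧ Φ t' ∧ bitsToNat t' ≤ bitsToNat t

/-- `Below S Φ t`: some `S`-bit word satisfying `Φ` has value `< ⟦t⟧`. [cite: ChenEtAl2022, §5.3] -/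
def Below (t : List Bool) : Prop := ∃ t' : List Bool, t'.length = S ∧ Φ t' ∧ bitsToNat t' < bitsToNat t

variable {S Φ}

/-- `QLe` is upward closed in the value. [folklore] -/
theorem QLe.mono {t u : List Bool} (h : QLe S Φ t) (htu : bitsToNat t ≤ bitsToNat u) : QLe S Φ u := by
  obtain ⟨t', h1, h2, h3⟩ := h
  exact ⟨t', h1, h2, h3.trans htu⟩

/-- `Below` is upward closed in the value. [folklore] -/
theorem Below.mono {t u : List Bool} (h : Below S Φ t) (htu : bitsToNat t ≤ bitsToNat u) : Below S Φ u := by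
  obtain ⟨t', h1, h2, h3⟩ := h
  exact ⟨t', h1, h2, h3.trans_le htu⟩

/-- `Below → QLe`. [folklore] -/
theorem Below.qLe {t : List Bool} (h : Below S Φ t) : QLe S Φ t := by
  obtain ⟨t', h1, h2, h3⟩ := h
  exact ⟨t', h1, h2, h3.le⟩

/-- A `Φ`-word is at or below itself. [folklore] -/
theorem qLe_self {t : List Bool} (ht : t.length = S) (hΦ : Φ t) : QLe S Φ t := ⟨t, ht, hΦ, le_rfl⟩

/-- If `Φ` has an `S`-bit word then the top word `1^S` has a `Φ`-word at or below it. [folklore] -/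
theorem qLe_ones (h : ∃ t' : List Bool, t'.length = S ∧ Φ t') : QLe S Φ (ones S) := by
  obtain ⟨t', h1, h2⟩ := h
  exact ⟨t', h1, h2, bitsToNat_le_bitsToNat_ones h1⟩

/-- A `Φ`-word strictly below `t` is at or below `predLE t`. [folklore] -/
theorem Below.qLe_predLE {t : List Bool} (h : Below S Φ t) : QLe S Φ (predLE t) := by
  obtain ⟨t', h1, h2, h3⟩ := h
  refine ⟨t', h1, h2, ?_⟩
  rw [bitsToNat_predLE (by omega)]
  omega

/-- Nothing is strictly below a word of value `0`. [folklore] -/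
theorem not_below_of_bitsToNat_eq_zero {t : List Bool} (h : bitsToNat t = 0) : ¬ Below S Φ t := by
  rintro ⟨t', -, -, h3⟩
  omega

/-- **Trichotomy.** Every `S`-bit word is the minimum of `Φ` (in `Φ`, nothing of `Φ` strictly
below), or has a `Φ`-word strictly below it, or has no `Φ`-word at or below it. [folklore] -/
theorem trichotomy {t : List Bool} (ht : t.length = S) :
    (Φ t ∧ ¬ Below S Φ t) ∨ Below S Φ t ∨ ¬ QLe S Φ t := by
  by_cases hb : Below S Φ t
  · exact Or.inr (Or.inl hb)
  by_cases hΦ : Φ t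
  · exact Or.inl ⟨hΦ, hb⟩
  refine Or.inr (Or.inr ?_)
  rintro ⟨t', h1, h2, h3⟩
  rcases h3.lt_or_eq with hlt | heq
  · exact hb ⟨t', h1, h2, hlt⟩
  · exact hΦ (Kannan.eq_of_bitsToNat_eq (h1.trans ht.symm) heq ▸ h2)

/-- **The minimum is unique**: a `Φ`-word `a` whose value is at most that of a word `c` with
nothing of `Φ` strictly below is `c` itself. [folklore] -/
theorem eq_of_not_below {a c : List Bool} (ha : a.length = S) (hc : c.length = S) (hΦ : Φ a)
    (hcb : ¬ Below S Φ c) (hle : bitsToNat a ≤ bitsToNat c) : a = c := by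
  rcases hle.lt_or_eq with hlt | heq
  · exact absurd ⟨a, ha, hΦ, hlt⟩ hcb
  · exact Kannan.eq_of_bitsToNat_eq (ha.trans hc.symm) heq

/-- Two minima of `Φ` coincide. [folklore] -/
theorem eq_of_isMin {a c : List Bool} (ha : a.length = S) (hc : c.length = S) (hΦa : Φ a)
    (hab : ¬ Below S Φ a) (hΦc : Φ c) (hcb : ¬ Below S Φ c) : a = c := by
  rcases le_total (bitsToNat a) (bitsToNat c) with h | h
  · exact eq_of_not_below ha hc hΦa hcb h
  · exact (eq_of_not_below hc ha hΦc hab h).symm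

end Order

/-! ### Guilt: the local certificates of a run -/

section Guilt

variable {S : ℕ} {Φ : List Bool → Prop} {ans tv : List Bool → Bool}

/-- `Guilty ans tv t`: the observed answer on the proxy of `t` differs from its true value — in the
application, the refuted language errs on that proxy string. [cite: ChenEtAl2022, §5.3] -/
def Guilty (ans tv : List Bool → Bool) (t : List Bool) : Prop := tv t ≠ ans t

/-- **A NO at the top is wrong when `Φ` is nonempty.** [cite: ChenEtAl2022, §5.1 (proof of the theorem "Refuters for PSPACE, EXP, and NEXP", case `|x| = 0`)] -/
theorem guilty_ones (htv : ∀ t : List Bool, t.length = S → (tv t = true ↔ QLe S Φ t))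
    (hne : ∃ t' : List Bool, t'.length = S ∧ Φ t') (hz : ans (ones S) = false) :
    Guilty ans tv (ones S) := by
  have h1 : tv (ones S) = true := (htv _ (length_ones' S)).2 (qLe_ones hne)
  simp [Guilty, h1, hz]

/-- **A `Φ`-word strictly below the result convicts the proxy of its predecessor**: the search
ended on the observed NO "nothing of `Φ` is `≤ predLE t̂`", which is false. [cite: ChenEtAl2022, §5.3] -/
theorem guilty_predLE_bsearch (htv : ∀ t : List Bool, t.length = S → (tv t = true ↔ QLe S Φ t))
    (hb : Below S Φ (bsearch ans S)) : Guilty ans tv (predLE (bsearch ans S)) := by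
  rcases bsearch_zeros_or ans S with h0 | hno
  · exact absurd hb (not_below_of_bitsToNat_eq_zero (by rw [h0, bitsToNat_zeros]))
  · have h1 : tv (predLE (bsearch ans S)) = true :=
      (htv _ (by rw [length_predLE, length_bsearch])).2 hb.qLe_predLE
    simp [Guilty, h1, hno]

/-- **No `Φ`-word at or below the result convicts the proxy of the result**: the search ended on
the observed YES "something of `Φ` is `≤ t̂`", which is false. [cite: ChenEtAl2022, §5.3] -/
theorem guilty_bsearch (htv : ∀ t : List Bool, t.length = S → (tv t = true ↔ QLe S Φ t))
    (htop : ans (ones S) = true) (hq : ¬ QLe S Φ (bsearch ans S)) : Guilty ans tv (bsearch ans S) := by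
  have h1 : tv (bsearch ans S) = false := by
    have := htv (bsearch ans S) (length_bsearch ans S)
    cases h : tv (bsearch ans S)
    · rfl
    · exact absurd ((this.1 h)) hq
  simp [Guilty, h1, ans_bsearch htop]

/-- **Trichotomy of a run.** For an oracle answering YES at the top, the result `t̂` is the minimum
of `Φ`, or the proxy of `predLE t̂` is guilty, or the proxy of `t̂` is guilty. (The three cases are
decided by the ideal data alone: `Φ t̂ ∧ ¬Below t̂` / `Below t̂` / `¬QLe t̂`.) [cite: ChenEtAl2022, §5.3] -/
theorem isMin_or_guilty (htv : ∀ t : List Bool, t.length = S → (tv t = true ↔ QLe S Φ t))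
    (htop : ans (ones S) = true) :
    (Φ (bsearch ans S) ∧ ¬ Below S Φ (bsearch ans S)) ∨
      (Below S Φ (bsearch ans S) ∧ Guilty ans tv (predLE (bsearch ans S))) ∨
      (¬ QLe S Φ (bsearch ans S) ∧ Guilty ans tv (bsearch ans S)) := by
  rcases trichotomy (Φ := Φ) (length_bsearch ans S) with h | h | h
  · exact Or.inl h
  · exact Or.inr (Or.inl ⟨h, guilty_predLE_bsearch htv h⟩)
  · exact Or.inr (Or.inr ⟨h, guilty_bsearch htv htop h⟩)

end Guilt

end ParityRefuter

end Literature.Computability.MetaComplexity
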